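import Summits.KontsevichZagierPeriods.KontsevichZagierPeriods.Theses.TorsionLogs
import Literature.NumberTheory.Transcendental.KZKernelConjectureForms

/-!
# Route KontsevichZagierPeriods/TorsionLogs — crux `TorsionSectorComplete` (stmt-KontsevichZagierPeriods-14212):
# where the crux sits — soundness, kernel form, and the reductions to and from the summit

Helper file (`--supports stmt-KontsevichZagierPeriods-14212`) of the line lead on the rank-9,
conjecture-grade crux
`Summit.KontsevichZagierPeriods.KontsevichZagierPeriods.Theses.TorsionLogs.TorsionSectorComplete`
(COMPLETENESS OF THE KZ CALCULUS RELATIVE TO THE NÉRON–TORSION SECTOR: for representations `r`,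
`r'` of KZ's rational shape with `r.value = r'.value`, `[r] − [r'] ∈ KZ.relations ⊔ closure T`,
where `T` is the set of tied Néron–torsion elements `M • [rI] + k • [rP] − m • [rL]`, the
hypotheses of `NeronTorsionSector` rev 2 repeated verbatim, tie `4N²k = M(N−2a)²` and value
hypothesis included).

Everything here is an unconditional theorem ABOUT the crux; nothing here claims the crux. The file
pins the crux in the tree exactly as the refuter's crux-attack (item evidence `CruxAttack.lean`,
2026-08-16) and the grounder (verdict open-problem) describe it:

* `enlarged_le_ker_eval` — SOUNDNESS OF THE ENLARGED CALCULUS: `KZ.relations ⊔ closure T ≤ ker eval`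
  (moves are sound, `KZ.relations_le_ker_eval_holds`; every tied element evaluates to `0` by its
  own value hypothesis, `closure_tied_le_ker_eval`).
* `iff_kernelForm` — KERNEL FORM: the crux is equivalent to
  `∀ c, KZ.eval c = 0 → c ∈ KZ.relations ⊔ closure T` (merge `KZ.exists_integralRep_sub_holds`,
  rationalise `KZ.exists_isRational_equivalent_holds`, soundness).
* `of_summit`, `of_kzKernelConjecture`, `of_kzPeriodConjecture'` — the summit
  `KontsevichZagierPeriods`, and each Literature form of Kontsevich–Zagier's Conjecture 1
  (`Literature.NumberTheory.Transcendental.KZKernelConjecture`, `KZPeriodConjecture'`, both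
  registered OPEN statements, tree-proved equivalent to the summit), imply the crux
  (`relations ≤ relations ⊔ closure T`).
* `neronTorsionSector_of_summit` — the summit also implies the route's sector crux
  `NeronTorsionSector` (a tied element has value `0`, and the summit is the kernel conjecture).
* `summit_iff_sector_and_complete` — `KontsevichZagierPeriods ↔ NeronTorsionSector ∧ TorsionSectorComplete`:
  the route's thesis "sector + relative completeness = the whole summit", as an `iff`.
* `iff_summit_of_sector` — given the sector, the crux IS the summit; `not_summit_of_not` — a
  refutation of the crux refutes the summit (the route's kill criterion for this item).

Consequently the crux is closed MODULO the one existing open statement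
`Literature.NumberTheory.Transcendental.KZKernelConjecture` (↔ the summit,
`kzKernelConjecture_iff_isRational`), and is refutable only by refuting `KontsevichZagierPeriods`.

Sources: M. Kontsevich, D. Zagier, *Periods* (2001), §1.1 (remark after the Definition), §1.2
(rules 1–3, Conjecture 1); A. Huber, S. Müller-Stach, *Periods and Nori Motives* (2017), §13.1,
Conj. 13.2.1, Prop. 13.2.6. Deliberately NOT here: any partial case of the crux itself (the
dimension-`≤ 1` case is the sibling file `TorsionLogsTorsionSectorCompleteDimLeOne.lean`); no
definition is introduced (the set `T` is written out verbatim, as in the route file).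
-/

namespace Summit.KontsevichZagierPeriods.TorsionLogs.TorsionSectorComplete

open Literature.NumberTheory.Transcendental Literature.NumberTheory.Transcendental.KZ
open Summit.KontsevichZagierPeriods.KontsevichZagierPeriods.Theses.TorsionLogs

/-! ### Soundness of the enlarged calculus -/

/-- **Soundness of the sector.** Every tied Néron–torsion element `M • [rI] + k • [rP] − m • [rL]`
evaluates to `0`: its own value hypothesis `M·rI.value + k·rP.value = m·rL.value` is one of the
conjuncts defining `T`. Hence `closure T ≤ ker eval`. [Kontsevich–Zagier 2001, §1.2] [folklore] -/
theorem closure_tied_le_ker_eval :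
    AddSubgroup.closure {d : Literature.NumberTheory.Transcendental.KZ.FormalRep | ∃ (g₂ g₃ e₁ xP yP α : ℝ) (N a : ℕ) (M k m : ℤ) (f : ℝ → ℝ) (rI rP : Literature.NumberTheory.Transcendental.KZ.IntegralRep 2) (rL : Literature.NumberTheory.Transcendental.KZ.IntegralRep 1), (∀ x, f x = 4 * x ^ 3 - g₂ * x - g₃) ∧ g₂ ^ 3 - 27 * g₃ ^ 2 ≠ 0 ∧ f e₁ = 0 ∧ 0 < e₁ ∧ (∀ x, e₁ < x → 0 < f x) ∧ e₁ < xP ∧ yP ^ 2 = f xP ∧ 3 ≤ N ∧ 0 < a ∧ 2 * a < N ∧ 4 * (N : ℤ) ^ 2 * k = M * ((N : ℤ) - 2 * (a : ℤ)) ^ 2 ∧ (∀ hns : (⟨0, 0, 0, -g₂ / 4, -g₃ / 4⟩ : WeierstrassCurve ℝ).toAffine.Nonsingular xP (yP / 2), addOrderOf (WeierstrassCurve.Affine.Point.some xP (yP / 2) hns) = N) ∧ (N : ℝ) * (∫ x in Set.Ioi xP, (Real.sqrt (f x))⁻¹) = a * (2 * ∫ x in Set.Ioi e₁, (Real.sqrt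 (f x))⁻¹) ∧ 1 < α ∧ rI.domain = {z | e₁ < z 1 ∧ z 1 < z 0 ∧ z 0 < xP} ∧ Set.EqOn rI.integrand (fun z => z 1 / (Real.sqrt (f (z 1)) * Real.sqrt (f (z 0)))) rI.domain ∧ rP.domain = {z | e₁ < z 0 ∧ e₁ < z 1} ∧ Set.EqOn rP.integrand (fun z => (Real.sqrt (f (z 0)))⁻¹ * ((g₂ * z 1 + 2 * g₃) / (2 * (z 1) ^ 2 * Real.sqrt (f (z 1))))) rP.domain ∧ rL.domain = {t | 1 < t 0 ∧ t 0 < α} ∧ Set.EqOn rL.integrand (fun t => (t 0)⁻¹) rL.domain ∧ (M : ℝ) * rI.value + k * rP.value = m * rL.value ∧ d = M • Literature.NumberTheory.Transcendental.KZ.of rI + k • Literature.NumberTheory.Transcendental.KZ.of rP - m • Literature.NumberTheory.Transcendental.KZ.of rL} ≤ Literature.NumberTheory.Transcendental.KZ.eval.ker := by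
  refine (AddSubgroup.closure_le _).mpr ?_
  rintro d ⟨g₂, g₃, e₁, xP, yP, α, N, a, M, k, m', f, rI, rP, rL, -, -, -, -, -, -, -, -, -, -, -, -, -, -, -, -, -, -,
    -, -, hval, rfl⟩
  show _ ∈ Literature.NumberTheory.Transcendental.KZ.eval.ker
  rw [AddMonoidHom.mem_ker, map_sub, map_add, map_zsmul, map_zsmul, map_zsmul, eval_of, eval_of,
    eval_of, zsmul_eq_mul, zsmul_eq_mul, zsmul_eq_mul]
  linarith [hval]

/-- **Soundness of the enlarged calculus.** `KZ.relations ⊔ closure T ≤ ker eval`: the moves are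
sound (`KZ.relations_le_ker_eval_holds`) and the tied elements evaluate to `0`
(`closure_tied_le_ker_eval`). In particular the crux can only ever connect representations of
equal value — its value hypothesis is necessary. [Kontsevich–Zagier 2001, §1.2;
Huber–Müller-Stach 2017, §13.1] [folklore] -/
theorem enlarged_le_ker_eval :
    Literature.NumberTheory.Transcendental.KZ.relations ⊔ AddSubgroup.closure {d : Literature.NumberTheory.Transcendental.KZ.FormalRep | ∃ (g₂ g₃ e₁ xP yP α : ℝ) (N a : ℕ) (M k m : ℤ) (f : ℝ → ℝ) (rI rP : Literature.NumberTheory.Transcendental.KZ.IntegralRep 2) (rL : Literature.NumberTheory.Transcendental.KZ.IntegralRep 1), (∀ x, f x = 4 * x ^ 3 - g₂ * x - g₃) ∧ g₂ ^ 3 - 27 * g₃ ^ 2 ≠ 0 ∧ f e₁ = 0 ∧ 0 < e₁ ∧ (∀ x, e₁ < x → 0 < f x) ∧ e₁ < xP ∧ yP ^ 2 = f xP ∧ 3 ≤ N ∧ 0 < a ∧ 2 * a < N ∧ 4 * (N : ℤ) ^ 2 * k = M * ((N : ℤ) - 2 * (a : ℤ)) ^ 2 ∧ (∀ hns : (⟨0,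 0, 0, -g₂ / 4, -g₃ / 4⟩ : WeierstrassCurve ℝ).toAffine.Nonsingular xP (yP / 2), addOrderOf (WeierstrassCurve.Affine.Point.some xP (yP / 2) hns) = N) ∧ (N : ℝ) * (∫ x in Set.Ioi xP, (Real.sqrt (f x))⁻¹) = a * (2 * ∫ x in Set.Ioi e₁, (Real.sqrt (f x))⁻¹) ∧ 1 < α ∧ rI.domain = {z | e₁ < z 1 ∧ z 1 < z 0 ∧ z 0 < xP} ∧ Set.EqOn rI.integrand (fun z => z 1 / (Real.sqrt (f (z 1)) * Real.sqrt (f (z 0)))) rI.domain ∧ rP.domain = {z | e₁ < z 0 ∧ e₁ < z 1} ∧ Set.EqOn rP.integrand (fun z => (Real.sqrt (f (z 0)))⁻¹ * ((g₂ * z 1 + 2 * g₃) / (2 * (z 1) ^ 2 * Real.sqrt (f (z 1))))) rP.domain ∧ rL.domain = {t | 1 < t 0 ∧ t 0 < α} ∧ Set.EqOn rL.integrand (fun t => (t 0)⁻¹) rL.domain ∧ (M : ℝ) * rI.value + k * rP.value = m * rL.value ∧ d = M • Literature.NumberTheory.Transcendental.KZ.of rI + k • Literature.NumberTheory.Transcendental.KZ.of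 rP - m • Literature.NumberTheory.Transcendental.KZ.of rL} ≤
      Literature.NumberTheory.Transcendental.KZ.eval.ker :=
  sup_le relations_le_ker_eval_holds closure_tied_le_ker_eval

/-! ### Kernel form -/

/-- **Kernel form of the crux.** `TorsionSectorComplete` holds if and only if every formal
`ℤ`-combination of integral representations with value `0` lies in `KZ.relations ⊔ closure T`.
(⇒) merge `c ≡ [r] − [r']` modulo moves (`KZ.exists_integralRep_sub_holds`), rationalise both ends
(`KZ.exists_isRational_equivalent_holds`), read `r₁.value = r₁'.value` off soundness
(`KZ.relations_le_ker_eval_holds`), apply the crux to the rational pair and climb back through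
`relations ≤ relations ⊔ closure T`; (⇐) `eval ([r] − [r']) = r.value − r'.value = 0`.
[Kontsevich–Zagier 2001, §1.1 (remark after the Definition), §1.2; Huber–Müller-Stach 2017,
Conj. 13.2.1] [folklore] -/
theorem iff_kernelForm :
    TorsionSectorComplete ↔
      ∀ c : Literature.NumberTheory.Transcendental.KZ.FormalRep,
        Literature.NumberTheory.Transcendental.KZ.eval c = 0 →
          c ∈ Literature.NumberTheory.Transcendental.KZ.relations ⊔ AddSubgroup.closure {d : Literature.NumberTheory.Transcendental.KZ.FormalRep | ∃ (g₂ g₃ e₁ xP yP α : ℝ) (N a : ℕ) (M k m : ℤ) (f : ℝ → ℝ) (rI rP : Literature.NumberTheory.Transcendental.KZ.IntegralRep 2) (rL : Literature.NumberTheory.Transcendental.KZ.IntegralRep 1), (∀ x, f x = 4 * x ^ 3 - g₂ * x - g₃) ∧ g₂ ^ 3 - 27 * g₃ ^ 2 ≠ 0 ∧ f e₁ = 0 ∧ 0 < e₁ ∧ (∀ x, e₁ < x → 0 < f x) ∧ e₁ < xP ∧ yP ^ 2 = f xP ∧ 3 ≤ N ∧ 0 < a ∧ 2 * a < N ∧ 4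 * (N : ℤ) ^ 2 * k = M * ((N : ℤ) - 2 * (a : ℤ)) ^ 2 ∧ (∀ hns : (⟨0, 0, 0, -g₂ / 4, -g₃ / 4⟩ : WeierstrassCurve ℝ).toAffine.Nonsingular xP (yP / 2), addOrderOf (WeierstrassCurve.Affine.Point.some xP (yP / 2) hns) = N) ∧ (N : ℝ) * (∫ x in Set.Ioi xP, (Real.sqrt (f x))⁻¹) = a * (2 * ∫ x in Set.Ioi e₁, (Real.sqrt (f x))⁻¹) ∧ 1 < α ∧ rI.domain = {z | e₁ < z 1 ∧ z 1 < z 0 ∧ z 0 < xP} ∧ Set.EqOn rI.integrand (fun z => z 1 / (Real.sqrt (f (z 1)) * Real.sqrt (f (z 0)))) rI.domain ∧ rP.domain = {z | e₁ < z 0 ∧ e₁ < z 1} ∧ Set.EqOn rP.integrand (fun z => (Real.sqrt (f (z 0)))⁻¹ * ((g₂ * z 1 + 2 * g₃) / (2 * (z 1) ^ 2 * Real.sqrt (f (z 1))))) rP.domain ∧ rL.domain = {t | 1 < t 0 ∧ t 0 < α} ∧ Set.EqOn rL.integrand (fun t => (t 0)⁻¹) rL.domain ∧ (M : ℝ) *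 rI.value + k * rP.value = m * rL.value ∧ d = M • Literature.NumberTheory.Transcendental.KZ.of rI + k • Literature.NumberTheory.Transcendental.KZ.of rP - m • Literature.NumberTheory.Transcendental.KZ.of rL} := by
  constructor
  · intro hC c hc0
    -- merge: `c ≡ [r] − [r']` modulo moves
    obtain ⟨n, m, r, r', hmerge⟩ := exists_integralRep_sub_holds c
    -- rationalise both ends
    obtain ⟨n₁, r₁, hr₁, he₁⟩ := exists_isRational_equivalent_holds r
    obtain ⟨m₁, r₁', hr₁', he₁'⟩ := exists_isRational_equivalent_holds r'
    have hdiff : c - (of r₁ - of r₁') ∈ Literature.NumberTheory.Transcendental.KZ.relations := by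
      have : c - (of r₁ - of r₁') = (c - (of r - of r')) + (of r - of r₁) - (of r' - of r₁') := by abel
      rw [this]
      exact relations.sub_mem (relations.add_mem hmerge he₁) he₁'
    -- the rational pair has equal values
    have hv : r₁.value = r₁'.value := by
      have h0 : Literature.NumberTheory.Transcendental.KZ.eval (c - (of r₁ - of r₁')) = 0 :=
        relations_le_ker_eval_holds hdiff
      rw [map_sub, map_sub, eval_of, eval_of, hc0, zero_sub, neg_sub, sub_eq_zero] at h0
      exact h0.symm
    -- the crux on the rational pair, then climb back
    have hpair := hC r₁ r₁' hr₁ hr₁' hv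
    have : c = (c - (of r₁ - of r₁')) + (of r₁ - of r₁') := by abel
    rw [this]
    exact AddSubgroup.add_mem _ (AddSubgroup.mem_sup_left hdiff) hpair
  · intro hK n m r r' _ _ hv
    exact hK _ (by rw [map_sub, eval_of, eval_of, hv, sub_self])

/-- **The rationality hypotheses are not load-bearing.** The crux is equivalent to the same
statement for ALL integral representations (semialgebraic integrands), by the kernel form.
[Kontsevich–Zagier 2001, §1.1 (remark after the Definition)] [folklore] -/
theorem iff_withoutRational :
    TorsionSectorComplete ↔
      ∀ ⦃n m : ℕ⦄ (r : Literature.NumberTheory.Transcendental.KZ.IntegralRep n)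
        (r' : Literature.NumberTheory.Transcendental.KZ.IntegralRep m), r.value = r'.value →
        Literature.NumberTheory.Transcendental.KZ.of r - Literature.NumberTheory.Transcendental.KZ.of r' ∈
          Literature.NumberTheory.Transcendental.KZ.relations ⊔ AddSubgroup.closure {d : Literature.NumberTheory.Transcendental.KZ.FormalRep | ∃ (g₂ g₃ e₁ xP yP α : ℝ) (N a : ℕ) (M k m : ℤ) (f : ℝ → ℝ) (rI rP : Literature.NumberTheory.Transcendental.KZ.IntegralRep 2) (rL : Literature.NumberTheory.Transcendental.KZ.IntegralRep 1), (∀ x, f x = 4 * x ^ 3 - g₂ * x - g₃) ∧ g₂ ^ 3 - 27 * g₃ ^ 2 ≠ 0 ∧ f e₁ = 0 ∧ 0 < e₁ ∧ (∀ x, e₁ < x → 0 < f x) ∧ e₁ < xP ∧ yP ^ 2 = f xP ∧ 3 ≤ N ∧ 0 < a ∧ 2 * a < N ∧ 4 * (N : ℤ) ^ 2 * k = M * ((N : ℤ) - 2 * (a : ℤ)) ^ 2 ∧ (∀ hns : (⟨0, 0, 0, -g₂ / 4, -g₃ / 4⟩ : WeierstrassCurve ℝ).toAffine.Nonsingular xP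 (yP / 2), addOrderOf (WeierstrassCurve.Affine.Point.some xP (yP / 2) hns) = N) ∧ (N : ℝ) * (∫ x in Set.Ioi xP, (Real.sqrt (f x))⁻¹) = a * (2 * ∫ x in Set.Ioi e₁, (Real.sqrt (f x))⁻¹) ∧ 1 < α ∧ rI.domain = {z | e₁ < z 1 ∧ z 1 < z 0 ∧ z 0 < xP} ∧ Set.EqOn rI.integrand (fun z => z 1 / (Real.sqrt (f (z 1)) * Real.sqrt (f (z 0)))) rI.domain ∧ rP.domain = {z | e₁ < z 0 ∧ e₁ < z 1} ∧ Set.EqOn rP.integrand (fun z => (Real.sqrt (f (z 0)))⁻¹ * ((g₂ * z 1 + 2 * g₃) / (2 * (z 1) ^ 2 * Real.sqrt (f (z 1))))) rP.domain ∧ rL.domain = {t | 1 < t 0 ∧ t 0 < α} ∧ Set.EqOn rL.integrand (fun t => (t 0)⁻¹) rL.domain ∧ (M : ℝ) * rI.value + k * rP.value = m * rL.value ∧ d = M • Literature.NumberTheory.Transcendental.KZ.of rI + k • Literature.NumberTheory.Transcendental.KZ.of rP - m • Literature.NumberTheory.Transcendental.KZ.of rL} := by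
  rw [iff_kernelForm]
  constructor
  · intro hK n m r r' hv
    exact hK _ (by rw [map_sub, eval_of, eval_of, hv, sub_self])
  · intro h c hc0
    obtain ⟨n, m, r, r', hmerge⟩ := exists_integralRep_sub_holds c
    have hv : r.value = r'.value := by
      have h0 : Literature.NumberTheory.Transcendental.KZ.eval (c - (of r - of r')) = 0 :=
        relations_le_ker_eval_holds hmerge
      rw [map_sub, map_sub, eval_of, eval_of, hc0, zero_sub, neg_sub, sub_eq_zero] at h0
      exact h0.symm
    have : c = (c - (of r - of r')) + (of r - of r') := by abel
    rw [this]
    exact AddSubgroup.add_mem _ (AddSubgroup.mem_sup_left hmerge) (h r r' hv)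

/-! ### The summit and Conjecture 1 imply the crux -/

/-- **The summit implies the crux**: `KZ.relations ≤ KZ.relations ⊔ closure T`. So the crux is
refutable only by refuting `KontsevichZagierPeriods`. [Kontsevich–Zagier 2001, §1.2 Conjecture 1]
[folklore] -/
theorem of_summit (h : _root_.KontsevichZagierPeriods) : TorsionSectorComplete := by
  intro n m r r' hr hr' hv
  exact AddSubgroup.mem_sup_left (h r r' hr hr' hv)

/-- **A refutation of the crux refutes the summit** (the route's kill criterion for this item,
contrapositive of `of_summit`). [folklore] -/
theorem not_summit_of_not (h : ¬ TorsionSectorComplete) : ¬ _root_.KontsevichZagierPeriods :=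
  fun hs => h (of_summit hs)

/-- **The kernel form of Conjecture 1 implies the crux.** The registered open statement
`Literature.NumberTheory.Transcendental.KZKernelConjecture` (`ker eval = relations`; Kontsevich–Zagier
2001 Conjecture 1 in the shape of Huber–Müller-Stach 2017 Conj. 13.2.1) is tree-proved equivalent to
the summit (`kzKernelConjecture_iff_isRational`), hence implies the crux. This is the one existing
named statement modulo which the crux is closed. [Kontsevich–Zagier 2001, §1.2 Conjecture 1]
[folklore] -/
theorem of_kzKernelConjecture :
    Literature.NumberTheory.Transcendental.KZKernelConjecture → Summit.KontsevichZagierPeriods.KontsevichZagierPeriods.Theses.TorsionLogs.TorsionSectorComplete :=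
  fun h => of_summit (kzKernelConjecture_iff_isRational.mp h)

/-- **The all-semialgebraic form of Conjecture 1 implies the crux** (via
`KZKernelConjecture.of_kzPeriodConjecture'`). [Kontsevich–Zagier 2001, §1.2 Conjecture 1] [folklore] -/
theorem of_kzPeriodConjecture' (h : KZPeriodConjecture') : TorsionSectorComplete :=
  of_kzKernelConjecture (KZKernelConjecture.of_kzPeriodConjecture' h)

/-! ### Sector + relative completeness = the summit -/

/-- **The summit implies the sector crux** `NeronTorsionSector`: a tied Néron–torsion element has
value `0` by its value hypothesis, and the summit is the kernel conjecture
(`kzKernelConjecture_iff_isRational`), so the element is a relation. [Kontsevich–Zagier 2001, §1.2]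
[folklore] -/
theorem neronTorsionSector_of_summit (h : _root_.KontsevichZagierPeriods) : NeronTorsionSector := by
  have hK : KZKernelConjecture := kzKernelConjecture_iff_isRational.mpr h
  intro g₂ g₃ e₁ xP yP α N a M k m f _ _ _ _ _ _ _ _ _ _ _ _ _ _ rI rP rL _ _ _ _ _ _ hval
  apply hK
  rw [map_sub, map_add, map_zsmul, map_zsmul, map_zsmul, eval_of, eval_of, eval_of, zsmul_eq_mul,
    zsmul_eq_mul, zsmul_eq_mul]
  linarith [hval]

/-- **Given the sector, the crux is the summit**: `NeronTorsionSector → (TorsionSectorComplete ↔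
KontsevichZagierPeriods)` — forward by the route's deciding theorem `closes`, backward by
`of_summit`. This is the precise sense in which the crux "restates the summit modulo the sector"
(refuter crux-attack). [folklore] -/
theorem iff_summit_of_sector (h₁ : NeronTorsionSector) :
    TorsionSectorComplete ↔ _root_.KontsevichZagierPeriods :=
  ⟨closes h₁, of_summit⟩

/-- **Sector + relative completeness = the whole summit**, as an equivalence:
`KontsevichZagierPeriods ↔ NeronTorsionSector ∧ TorsionSectorComplete` (the route's thesis; forward
by `neronTorsionSector_of_summit` and `of_summit`, backward by `closes`). [folklore] -/
theorem summit_iff_sector_and_complete :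
    KontsevichZagierPeriods ↔ Summit.KontsevichZagierPeriods.KontsevichZagierPeriods.Theses.TorsionLogs.NeronTorsionSector ∧ Summit.KontsevichZagierPeriods.KontsevichZagierPeriods.Theses.TorsionLogs.TorsionSectorComplete :=
  ⟨fun h => ⟨neronTorsionSector_of_summit h, of_summit h⟩, fun h => closes h.1 h.2⟩

end Summit.KontsevichZagierPeriods.TorsionLogs.TorsionSectorComplete
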